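import Mathlib.RingTheory.Ideal.Operations
import Mathlib.RingTheory.Ideal.Maps
import Literature.AlgebraicGeometry.Resolution.CobordantBlowupRegularCentre
import HarnessLib

/-!
# [OURS · L1 W4.5(b) · EL♮] THE COMPANION-TOUCH CHART: after blowing up a companion nose the ambient acquires a surface of BAD points over the
# companion curve, and the strict transform is nevertheless REGULAR there — model form of COMPANIONS ADDENDUM C §C.9
# (crux `EquisingularLiftNat` = stmt-ResolutionOfSingularities-20038; PARENT ≥ 4 band / kill test #50 K5-BMY)

HONEST FRAMING. OURS (cell res-hironaka, crux chain w45b, slot W4.5(b)); NOT a statement of any manuscript; replaces the role of NOTHING in the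
manuscript; AI-written, AI review is weaker than expert review. Helper `--supports stmt-ResolutionOfSingularities-20038 --as helper`. Memo
`L/res-L1-w45b-lead-1/COMPANIONS-ADDENDUM-C.md` §C.9 (res-L1-w45b-lead-1 gen 9).

THE CHART (§C.9). At a general point `z` of a companion curve `D` choose coordinates `(s₁, s₂, t, n₁, n₂)` with the avatar `S = {t = n₁ = n₂ = 0}`,
the shadow `M = {n = 0}`, the companion `R = {n = 0, s₂ = 0}`; the regular nose is `C = V(n₁, n₂, t·s₂ − ϖ)`. In the chart `T₁ = 1` of
`Bl_C ℙ⁵_O` one has `n₂ = n₁v₂` and the uniformiser becomes `ϖ = t·s₂ − n₁·v_f =: r` — a quadric in four of the six regular coordinates, so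
`ϖ ∈ 𝔪²` along `B₁ = {t = s₂ = n₁ = v_f = 0}`: **a surface of BAD points is created** (`r_mem_sq`). The MODEL hypersurface is the quadratic part of
`G` in adapted coordinates, `G = Q·n₁² + b₁·t·n₁ + b₂·t·n₂ + λ·t²·s₂` with `b₁` a unit (rank `q_z = 3` together with the isotropy `q_tt|_D = 0`, written
`q_tt = λ·s₂`), i.e. after `n₂ = n₁ v₂`: `G = Q n₁² + b₁ t n₁ + b₂ t n₁ v₂ + λ t² s₂`. Put `G′ := Q n₁ + b₁ t + b₂ t v₂ + λ t v_f`,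
`q″ := Q s₂ + (b₁ + b₂ v₂ + λ v_f)·v_f`, `u := b₁ + b₂ v₂ + λ v_f` (a unit at the bad point); all written out in the statements (no `def`s).

THE FACTS. (`G_eq`) `G = n₁·G′ + λ·t·r`: modulo the chart relation `r = ϖ` the total transform is `n₁·G′` (one factor of the exceptional equation
`n₁`). (`s₂_mul_G'_eq`) `s₂·G′ = n₁·q″ + u·r`: since the special fibre `{r = 0}` is a domain this says `s₂·G′ ∈ (n₁)` there, so `q″ = s₂G′/n₁` ALSO lies
in the ideal of the strict transform `V((G) : n₁^∞)`. (`r_mem_span_chart`, `mem_span_pair_of_eq`) because `u` is a unit, `r ∈ (G′, q″)`: on the strict transform the bad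
relation is REDUNDANT. (`isRegularLocalRing_quotient_chart`, abstract form `isRegularLocalRing_quotient_of_eq`) hence, in any regular local ring `𝒪` (the local ring of the chart at the bad point)
where `G′, q″` have linearly independent differentials (`b₁ dt + Q dn₁`, `b₁ dv_f + Q ds₂` — independent as `b₁ ≠ 0`), the quotient
`𝒪 ⧸ (r, G′, q″)` is a REGULAR local ring: **the strict transform is regular at the generic new bad point** (by hand the same holds for the full `G`,
§C.9 (ii); here the quadratic model). Consequence recorded in the memo: after one companion touch the strict transform of `H` is regular off finitely
many fibres — kill test #50 is exactly the non-existence of companion noses.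

References: memo COMPANIONS-ADDENDUM-C.md §C.9; tree `Literature.AlgebraicGeometry.Resolution.isRegularLocalRing_quotient_span_range`
[cite: Matsumura1987, Thm. 14.2]; [StacksProject, Tag 080E] (strict transform = saturation by the exceptional equation). [folklore]
-/

set_option linter.dupNamespace false -- mandated namespace `Summit.<Summit>.<Problem>` of this single-conjunct summit

universe u

namespace Summit.ResolutionOfSingularities.ResolutionOfSingularities.Cruxes.EquisingularLiftNat.Sections

namespace CompanionTouchChart

variable {A : Type u} [CommRing A]

/-! Coordinates of the chart `T₁ = 1`: `s₂, t, n₁, vf (= v_f), v₂`; model coefficients `Q, b₁, b₂, lam (= λ)`. The named expressions of the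
docstring are written out: `r = t*s₂ - n₁*vf`, `G = Q*n₁^2 + b₁*t*n₁ + b₂*t*n₁*v₂ + lam*t^2*s₂`, `G′ = Q*n₁ + b₁*t + b₂*t*v₂ + lam*t*vf`,
`u = b₁ + b₂*v₂ + lam*vf`, `q″ = Q*s₂ + u*vf` (no `def`s: kernel lane). -/

/-- **`G = n₁·G′ + λ·t·r`**: modulo `r` (= `ϖ`) the total transform of the model hypersurface is `n₁·G′` (one factor of the exceptional equation).
[folklore] -/
theorem G_eq (Q b₁ b₂ lam s₂ t n₁ vf v₂ : A) :
    Q * n₁ ^ 2 + b₁ * t * n₁ + b₂ * t * n₁ * v₂ + lam * t ^ 2 * s₂ =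
      n₁ * (Q * n₁ + b₁ * t + b₂ * t * v₂ + lam * t * vf) + lam * t * (t * s₂ - n₁ * vf) := by
  ring

/-- **`s₂·G′ = n₁·q″ + u·r`**: on the special fibre (`r = 0`, a domain) `s₂·G′` is divisible by the exceptional equation `n₁`, so `q″ = s₂G′/n₁`
ALSO lies in the saturation `(G′) : n₁^∞` — the ideal of the strict transform. [folklore] -/
theorem s₂_mul_G'_eq (Q b₁ b₂ lam s₂ t n₁ vf v₂ : A) :
    s₂ * (Q * n₁ + b₁ * t + b₂ * t * v₂ + lam * t * vf) =
      n₁ * (Q * s₂ + (b₁ + b₂ * v₂ + lam * vf) * vf) + (b₁ + b₂ * v₂ + lam * vf) * (t * s₂ - n₁ * vf) := by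
  ring

/-- **BAD POINTS ARE CREATED**: `r = t·s₂ − n₁·v_f ∈ I²` for every ideal `I` containing `t, s₂, n₁, v_f` (e.g. the maximal ideal of any point of
`B₁ = {t = s₂ = n₁ = v_f = 0}`): there `ϖ = r ∈ 𝔪²`. [folklore] -/
theorem r_mem_sq {I : Ideal A} {s₂ t n₁ vf : A} (ht : t ∈ I) (hs : s₂ ∈ I) (hn : n₁ ∈ I) (hv : vf ∈ I) :
    t * s₂ - n₁ * vf ∈ I ^ 2 := by
  rw [pow_two]
  exact Ideal.sub_mem _ (Ideal.mul_mem_mul ht hs) (Ideal.mul_mem_mul hn hv)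

/-- **The bad relation is redundant on the strict transform** (abstract mechanism): if `s₂·G′ = n₁·q″ + u·r` with `u` a unit, then `r ∈ (G′, q″)`.
[folklore] -/
theorem mem_span_pair_of_eq {r G' q'' u s₂ n₁ : A} (h : s₂ * G' = n₁ * q'' + u * r) (hu : IsUnit u) : r ∈ Ideal.span {G', q''} := by
  obtain ⟨w, hw⟩ := hu.exists_left_inv
  have hur : u * r = s₂ * G' - n₁ * q'' := by rw [h]; ring
  have : r = w * (s₂ * G' - n₁ * q'') := by rw [← hur, ← mul_assoc, hw, one_mul]
  rw [this]
  refine Ideal.mul_mem_left _ w (Ideal.sub_mem _ ?_ ?_)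
  · exact Ideal.mul_mem_left _ s₂ (Ideal.subset_span (by simp))
  · exact Ideal.mul_mem_left _ n₁ (Ideal.subset_span (by simp))

/-- Hence `(r, G′, q″) = (G′, q″)`. [folklore] -/
theorem span_triple_eq_span_pair {r G' q'' u s₂ n₁ : A} (h : s₂ * G' = n₁ * q'' + u * r) (hu : IsUnit u) :
    Ideal.span {r, G', q''} = Ideal.span {G', q''} := by
  apply le_antisymm
  · rw [Ideal.span_le]
    rintro x hx
    rcases hx with rfl | rfl | rfl
    · exact mem_span_pair_of_eq h hu
    · exact Ideal.subset_span (by simp)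
    · exact Ideal.subset_span (by simp)
  · exact Ideal.span_mono (by intro x hx; rcases hx with rfl | rfl <;> simp)

/-- In the chart: `r := t s₂ − n₁ v_f` lies in the ideal of the two strict-transform equations `G′, q″` as soon as `u = b₁ + b₂v₂ + λv_f` is a unit
(true at every point of `B₁`, where `u = b₁ ≠ 0`). [folklore] -/
theorem r_mem_span_chart {Q b₁ b₂ lam s₂ t n₁ vf v₂ : A} (hu : IsUnit (b₁ + b₂ * v₂ + lam * vf)) :
    t * s₂ - n₁ * vf ∈ Ideal.span {Q * n₁ + b₁ * t + b₂ * t * v₂ + lam * t * vf, Q * s₂ + (b₁ + b₂ * v₂ + lam * vf) * vf} :=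
  mem_span_pair_of_eq (s₂_mul_G'_eq Q b₁ b₂ lam s₂ t n₁ vf v₂) hu

/-- `Set.range ![a, b] = {a, b}`. [folklore] bookkeeping. -/
theorem range_pair {β : Type u} (a b : β) : Set.range ![a, b] = {a, b} := by
  ext x
  simp only [Set.mem_range, Set.mem_insert_iff, Set.mem_singleton_iff]
  constructor
  · rintro ⟨i, rfl⟩
    fin_cases i
    · exact Or.inl rfl
    · exact Or.inr rfl
  · rintro (rfl | rfl)
    · exact ⟨0, rfl⟩
    · exact ⟨1, rfl⟩

open IsLocalRing in
/-- **REGULARITY MECHANISM (abstract).** In a regular local ring `𝒪`, if `s₂·G′ = n₁·q″ + u·r` with `u` a unit and `G′, q″ ∈ 𝔪` have linearly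
independent differentials, then `𝒪 ⧸ (r, G′, q″)` is a regular local ring — even though `r` may lie in `𝔪²`. OURS. [folklore] (Matsumura 14.2 via the
tree's `isRegularLocalRing_quotient_span_range`.) -/
theorem isRegularLocalRing_quotient_of_eq {O : Type u} [CommRing O] [IsRegularLocalRing O] {r G' q'' u s₂ n₁ : O}
    (h : s₂ * G' = n₁ * q'' + u * r) (hu : IsUnit u) (hG : G' ∈ maximalIdeal O) (hq : q'' ∈ maximalIdeal O)
    (hli : LinearIndependent (ResidueField O) ![(maximalIdeal O).toCotangent ⟨G', hG⟩, (maximalIdeal O).toCotangent ⟨q'', hq⟩]) :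
    IsRegularLocalRing (O ⧸ Ideal.span {r, G', q''}) := by
  rw [span_triple_eq_span_pair h hu, ← range_pair]
  have hf : ∀ i, ![G', q''] i ∈ maximalIdeal O := by
    intro i; fin_cases i
    · exact hG
    · exact hq
  have hli' : LinearIndependent (ResidueField O) fun i => (maximalIdeal O).toCotangent ⟨![G', q''] i, hf i⟩ := by
    convert hli using 1
    funext i; fin_cases i <;> rfl
  exact Literature.AlgebraicGeometry.Resolution.isRegularLocalRing_quotient_span_range _ hf hli'

open IsLocalRing in
/-- **THE STRICT TRANSFORM IS REGULAR AT THE GENERIC NEW BAD POINT (model chart).** In the regular local ring `𝒪` of the chart `T₁ = 1` at a point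
of `B₁`, with `u = b₁ + b₂v₂ + λv_f` a unit and the two strict-transform equations `G′ = Qn₁ + b₁t + b₂tv₂ + λtv_f`, `q″ = Qs₂ + u·v_f` in `𝔪`
with linearly independent differentials (`b₁ dt + Q dn₁`, `b₁ dv_f + Q ds₂` — independent as `b₁ ≠ 0`), the quotient
`𝒪 ⧸ (t s₂ − n₁ v_f, G′, q″)` is a regular local ring, although `ϖ = t s₂ − n₁ v_f ∈ 𝔪²` there (`r_mem_sq`). OURS. [folklore] -/
theorem isRegularLocalRing_quotient_chart {O : Type u} [CommRing O] [IsRegularLocalRing O] {Q b₁ b₂ lam s₂ t n₁ vf v₂ : O}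
    (hu : IsUnit (b₁ + b₂ * v₂ + lam * vf))
    (hG : Q * n₁ + b₁ * t + b₂ * t * v₂ + lam * t * vf ∈ maximalIdeal O)
    (hq : Q * s₂ + (b₁ + b₂ * v₂ + lam * vf) * vf ∈ maximalIdeal O)
    (hli : LinearIndependent (ResidueField O)
      ![(maximalIdeal O).toCotangent ⟨Q * n₁ + b₁ * t + b₂ * t * v₂ + lam * t * vf, hG⟩,
        (maximalIdeal O).toCotangent ⟨Q * s₂ + (b₁ + b₂ * v₂ + lam * vf) * vf, hq⟩]) :
    IsRegularLocalRing (O ⧸ Ideal.span {t * s₂ - n₁ * vf, Q * n₁ + b₁ * t + b₂ * t * v₂ + lam * t * vf,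
      Q * s₂ + (b₁ + b₂ * v₂ + lam * vf) * vf}) :=
  isRegularLocalRing_quotient_of_eq (s₂_mul_G'_eq Q b₁ b₂ lam s₂ t n₁ vf v₂) hu hG hq hli

end CompanionTouchChart

end Summit.ResolutionOfSingularities.ResolutionOfSingularities.Cruxes.EquisingularLiftNat.Sections
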